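import Literature.Geometry.Symplectic.SteinBallSublevel
import Literature.Geometry.Symplectic.SteinFlatLeviExp
import Literature.Geometry.Symplectic.FlatSmoothMaxLevi
import Literature.Geometry.Symplectic.SteinHandleProfileInverse
import Literature.Geometry.Symplectic.SteinHandleProfileScaling
import HarnessLib

/-!
# The model Stein `2`-handle, capped inside the ball `B⁴ ⊂ ℂ²`, is a Stein domain

Topic `Literature/Geometry/Symplectic`; proofs file of the fact seat of
`Literature.Geometry.Symplectic.Gompf1998_thm13_twoHandles` (**E2**, `SteinTwoHandles.lean`:
Eliashberg's theorem that 2-handles attached to a Stein domain along Legendrian knots with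
framing `tb - 1` give a Stein domain).  The model of E2 in `ℂ²` is Eliashberg's strongly
pseudoconvex handlebody `K = {|x| ≤ h(|y|)} ⊃ D_λ ∪ M` (Eliashberg 1990, Lemma 3.4.3;
Forstnerič–Kozak 2003, Cor. 3.2), constructed and proved strongly pseudoconvex in
`SteinHandleProfile*.lean`, `SteinHandleDomain.lean` (any `HandleProfile h σ r₀`), with a
strictly plurisubharmonic defining function `e^{Cρ_K}` near compact parts of `∂K`
(`SteinFlatLeviExp.lean`).  Here we **cap `K` off by a ball and round the corner** with the
regularised maximum — `Ψ = m_δ(e^{Cρ_K} - 1, A(‖w‖² - R²))` — and prove that the resulting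
compact domain `G = {Ψ ≤ 0} ⊂ B(0,R) ⊂ B⁴` is a *regular strongly `J`-convex sublevel domain*:
`Ψ` is smooth, `dΨ ≠ 0` on `{Ψ ≥ 0} ∩ B̄⁴`, `Ψ` is strictly plurisubharmonic on `{Ψ ≤ 0}`
(on the collar of `∂K` by `SteinFlatLeviExp`, on the cap since `‖w‖²` is, in between by
`levi_flat_smoothMax_pos`), and `G ∩ B̄(0,R/2) = K ∩ B̄(0,R/2)`
(`HandleProfile.exists_cap_definingFunction`, in the coordinates of `J₁`;
`exists_cap_definingFunction_std` after the coordinate swap `σ`, `σJ₁σ = J₀`).  By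
`isSteinDomain_ballSublevel` (`SteinBallSublevel.lean`: regular strongly `J₀`-convex sublevel
domains of the ball are Stein domains, via the standard Stein structure of `B⁴` and
`SteinStructure.sublevelOf`) **`G` is a Stein domain in the tree's sense**
(`HandleProfile.isSteinDomain_cappedHandle`).  With the rescaled Forstnerič–Kozak profiles
`h_s` (`exists_handleProfile`, `HandleProfile.scale`) `G` contains, for `s` small, the whole
standard handle `(D_{λ,s²} ∪ 2-handle) ∩ B(0, R/2)`: an `IsSteinDomain` inhabitant realising
the model of Eliashberg's 2-handle attachment.

Everything is **proved**; definitions `swap12Lin`/`swap12` (the coordinate swap), `capF`,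
`capPsi`; no named fact.

## References

* Ya. Eliashberg, *Topological characterization of Stein manifolds of dimension > 2*,
  Internat. J. Math. 1 (1990), 29–46, Lemma 3.4.3. [Eliashberg1990Stein]
* F. Forstnerič, J. Kozak, *Strongly pseudoconvex handlebodies*, J. Korean Math. Soc. 40
  (2003), 727–745, Cor. 3.2. [ForstnericKozak2003]
* K. Cieliebak, Ya. Eliashberg, *From Stein to Weinstein and Back*, AMS Colloquium Publ. 59
  (2012), Def. 1.1 ff., §3.2 (smoothing of corners / maxima of `J`-convex functions).
  [CieliebakEliashberg2012]
-/

noncomputable section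

open scoped Manifold ContDiff Topology RealInnerProductSpace
open Set Function Metric Filter

namespace Literature.Geometry.Symplectic

open Literature.Analysis.Pluripotential Literature.Topology.FourManifolds

/-- The model vector space `ℝ⁴`. -/
local notation "E4" => EuclideanSpace ℝ (Fin 4)

/-- Local notation: the closed unit 4-ball. -/
local notation "𝔻⁴" => (Metric.closedBall (0 : EuclideanSpace ℝ (Fin 4)) 1)

attribute [local instance] fact_finrank_euclideanSpace_succ

/-! ### The coordinate swap `σ : (w₀,w₁,w₂,w₃) ↦ (w₀,w₂,w₁,w₃)` intertwining `J₁` and `J₀` -/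

/-- The coordinate permutation `σ (w₀, w₁, w₂, w₃) = (w₀, w₂, w₁, w₃)` as a linear map; it
conjugates the complex structure `J₁` of `SteinOneHandlebodies.lean` (`J₁∂₀ = ∂₂`) to the
standard `J₀` of `SteinBall.lean` (`J₀∂₀ = ∂₁`). [folklore] -/
def swap12Lin : E4 →ₗ[ℝ] E4 where
  toFun v := WithLp.toLp 2 ![v 0, v 2, v 1, v 3]
  map_add' v w := by ext i; fin_cases i <;> simp
  map_smul' c v := by ext i; fin_cases i <;> simp

/-- `σ` is an involution. [folklore] -/
theorem swap12Lin_swap12Lin (v : E4) : swap12Lin (swap12Lin v) = v := by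
  ext i; fin_cases i <;> rfl

/-- The coordinate swap `σ` as a continuous linear equivalence of `ℝ⁴` (its own inverse). [folklore] -/
def swap12 : E4 ≃L[ℝ] E4 :=
  { LinearEquiv.ofInvolutive swap12Lin swap12Lin_swap12Lin with
    continuous_toFun := (LinearMap.continuous_of_finiteDimensional _)
    continuous_invFun := (LinearMap.continuous_of_finiteDimensional _) }

/-- Coordinate `0` of `σ v` is `v₀`. [folklore] -/
@[simp] theorem swap12_apply_zero (v : E4) : swap12 v 0 = v 0 := rfl

/-- Coordinate `1` of `σ v` is `v₂`. [folklore] -/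
@[simp] theorem swap12_apply_one (v : E4) : swap12 v 1 = v 2 := rfl

/-- Coordinate `2` of `σ v` is `v₁`. [folklore] -/
@[simp] theorem swap12_apply_two (v : E4) : swap12 v 2 = v 1 := rfl

/-- Coordinate `3` of `σ v` is `v₃`. [folklore] -/
@[simp] theorem swap12_apply_three (v : E4) : swap12 v 3 = v 3 := rfl

/-- `σ² = 1`. [folklore] -/
@[simp] theorem swap12_swap12 (v : E4) : swap12 (swap12 v) = v := swap12Lin_swap12Lin v

/-- `σ⁻¹ = σ`. [folklore] -/
@[simp] theorem swap12_symm : swap12.symm = swap12 := rfl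

/-- `σ` is an isometry: `‖σ v‖ = ‖v‖`. [folklore] -/
@[simp] theorem norm_swap12 (v : E4) : ‖swap12 v‖ = ‖v‖ := by
  have h1 := norm_sq_four (swap12 v)
  have h2 := norm_sq_four v
  simp only [swap12_apply_zero, swap12_apply_one, swap12_apply_two, swap12_apply_three] at h1
  have : ‖swap12 v‖ ^ 2 = ‖v‖ ^ 2 := by rw [h1, h2]; ring
  exact (sq_eq_sq₀ (norm_nonneg _) (norm_nonneg _)).1 this

/-- **`σ` conjugates `J₀` to `J₁`**: `σ (J₀ v) = J₁ (σ v)`. [folklore] -/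
theorem swap12_stdComplexStructure (v : E4) :
    swap12 (stdComplexStructure v) = scaledComplexStructure 1 (swap12 v) := by
  ext i; fin_cases i <;> simp

/-- `J₁` is an isometry of `ℝ⁴`: `‖J₁ u‖ = ‖u‖`. [folklore] -/
@[simp] theorem norm_scaledComplexStructure_one (u : E4) : ‖scaledComplexStructure 1 u‖ = ‖u‖ := by
  have h1 := norm_sq_four (scaledComplexStructure 1 u)
  have h2 := norm_sq_four u
  simp only [scaledComplexStructure_apply_zero, scaledComplexStructure_apply_one,
    scaledComplexStructure_apply_two, scaledComplexStructure_apply_three, inv_one, one_mul] at h1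
  have : ‖scaledComplexStructure 1 u‖ ^ 2 = ‖u‖ ^ 2 := by rw [h1, h2]; ring
  exact (sq_eq_sq₀ (norm_nonneg _) (norm_nonneg _)).1 this

/-! ### Second derivatives under a linear change of variables -/

section CompRight

variable {E F : Type*} [NormedAddCommGroup E] [NormedSpace ℝ E] [NormedAddCommGroup F] [NormedSpace ℝ F]

/-- **Chain rule of second order for a linear change of variables**: for `f` twice
differentiable at `T x`, `D²(f ∘ T)_x (u, v) = D²f_{Tx} (Tu, Tv)`. [folklore] -/
theorem fderiv_fderiv_comp_continuousLinearEquiv (T : E ≃L[ℝ] F) {f : F → ℝ} {x : E}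
    (hf : DifferentiableAt ℝ (fderiv ℝ f) (T x)) (u v : E) :
    fderiv ℝ (fderiv ℝ (f ∘ T)) x u v = fderiv ℝ (fderiv ℝ f) (T x) (T u) (T v) := by
  have h1 : fderiv ℝ (f ∘ T) = fun y => (fderiv ℝ f (T y)).comp (T : E →L[ℝ] F) :=
    funext fun y => T.comp_right_fderiv
  rw [h1]
  set P : (F →L[ℝ] ℝ) →L[ℝ] (E →L[ℝ] ℝ) := (ContinuousLinearMap.compL ℝ E F ℝ).flip (T : E →L[ℝ] F)
    with hP
  have hP' : ∀ L : F →L[ℝ] ℝ, P L = L.comp (T : E →L[ℝ] F) := fun L => by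
    rw [hP, ContinuousLinearMap.flip_apply, ContinuousLinearMap.compL_apply]
  have h2 : (fun y => (fderiv ℝ f (T y)).comp (T : E →L[ℝ] F)) = fun y => P (fderiv ℝ f (T y)) :=
    funext fun y => (hP' _).symm
  rw [h2]
  have h3 : HasFDerivAt (fun y => fderiv ℝ f (T y)) ((fderiv ℝ (fderiv ℝ f) (T x)).comp (T : E →L[ℝ] F)) x :=
    hf.hasFDerivAt.comp x T.hasFDerivAt
  have h4 : HasFDerivAt (fun y => P (fderiv ℝ f (T y)))
      (P.comp ((fderiv ℝ (fderiv ℝ f) (T x)).comp (T : E →L[ℝ] F))) x :=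
    P.hasFDerivAt.comp x h3
  rw [h4.fderiv]
  simp only [ContinuousLinearMap.comp_apply]
  rw [hP', ContinuousLinearMap.comp_apply]
  rfl

end CompRight

/-- **The flat Levi forms for `J₀` and `J₁` correspond under `σ`**:
`L^{J₀}_{Ψ∘σ}(x)(u) = L^{J₁}_Ψ(σx)(σu)`. [folklore] -/
theorem levi_flat_comp_swap12 {Ψ : E4 → ℝ} (hΨ : ContDiff ℝ ∞ Ψ) (x u : E4) :
    fderiv ℝ (fderiv ℝ (Ψ ∘ swap12)) x u u +
        fderiv ℝ (fderiv ℝ (Ψ ∘ swap12)) x (stdComplexStructure u) (stdComplexStructure u) =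
      fderiv ℝ (fderiv ℝ Ψ) (swap12 x) (swap12 u) (swap12 u) +
        fderiv ℝ (fderiv ℝ Ψ) (swap12 x) (scaledComplexStructure 1 (swap12 u))
          (scaledComplexStructure 1 (swap12 u)) := by
  have hd : ∀ y, DifferentiableAt ℝ (fderiv ℝ Ψ) y := fun y =>
    ((hΨ.fderiv_right (m := ∞) (by norm_cast)).differentiable (by simp)) y
  rw [fderiv_fderiv_comp_continuousLinearEquiv swap12 (hd _),
    fderiv_fderiv_comp_continuousLinearEquiv swap12 (hd _), swap12_stdComplexStructure]

/-! ### The cap function `A(‖w‖² - R²)` -/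

/-- The cap function `cap_{A,R}(w) = A (‖w‖² - R²)`. [folklore] -/
def capF (A R : ℝ) (w : E4) : ℝ := A * (‖w‖ ^ 2 - R ^ 2)

/-- `d(cap)_w = 2A ⟪w, ·⟫`. [folklore] -/
theorem hasFDerivAt_capF (A R : ℝ) (w : E4) :
    HasFDerivAt (capF A R) ((2 * A) • innerSL ℝ w) w := by
  have h := ((hasFDerivAt_norm_sq_four w).sub_const (R ^ 2)).const_mul A
  refine h.congr_fderiv ?_
  ext v
  simp
  ring

/-- `fderiv` of the cap. [folklore] -/
theorem fderiv_capF (A R : ℝ) : fderiv ℝ (capF A R) = fun w => (2 * A) • innerSL ℝ w :=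
  funext fun w => (hasFDerivAt_capF A R w).fderiv

/-- `d(cap)_w v = 2A⟪w, v⟫`. [folklore] -/
theorem fderiv_capF_apply (A R : ℝ) (w v : E4) : fderiv ℝ (capF A R) w v = 2 * A * ⟪w, v⟫ := by
  rw [fderiv_capF]
  simp only [FunLike.coe_smul, Pi.smul_apply, innerSL_apply_apply, smul_eq_mul]

/-- `D²(cap)_w (u, v) = 2A ⟪u, v⟫`. [folklore] -/
theorem fderiv_fderiv_capF_apply (A R : ℝ) (w u v : E4) :
    fderiv ℝ (fderiv ℝ (capF A R)) w u v = 2 * A * ⟪u, v⟫ := by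
  rw [fderiv_capF]
  have h : HasFDerivAt (fun w : E4 => (2 * A) • innerSL ℝ w) ((2 * A) • (innerSL ℝ : E4 →L[ℝ] E4 →L[ℝ] ℝ)) w :=
    ((innerSL ℝ : E4 →L[ℝ] E4 →L[ℝ] ℝ).hasFDerivAt).const_smul (2 * A)
  rw [h.fderiv]
  show ((2 * A) • (innerSL ℝ u : E4 →L[ℝ] ℝ)) v = 2 * A * ⟪u, v⟫
  rw [FunLike.coe_smul, Pi.smul_apply, innerSL_apply_apply, smul_eq_mul]

/-- The cap is smooth. [folklore] -/
theorem contDiff_capF (A R : ℝ) : ContDiff ℝ ∞ (capF A R) :=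
  contDiff_const.mul ((contDiff_norm_sq ℝ).sub contDiff_const)

/-- **The cap is strictly `J₀`-plurisubharmonic** for `A > 0`:
`L^{J₀}_{cap}(w)(u) = 2A(‖u‖² + ‖J₀u‖²) = 4A‖u‖²`. [folklore] -/
theorem levi_flat_capF (A R : ℝ) (w u : E4) :
    fderiv ℝ (fderiv ℝ (capF A R)) w u u +
        fderiv ℝ (fderiv ℝ (capF A R)) w (stdComplexStructure u) (stdComplexStructure u) =
      4 * A * ‖u‖ ^ 2 := by
  rw [fderiv_fderiv_capF_apply, fderiv_fderiv_capF_apply, inner_stdComplexStructure_stdComplexStructure,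
    real_inner_self_eq_norm_sq]
  ring

/-- The cap is `σ`-invariant. [folklore] -/
theorem capF_comp_swap12 (A R : ℝ) : capF A R ∘ swap12 = capF A R := by
  funext w; simp [capF]

/-! ### A compactness lemma: thin shells around `∂K ∩ B̄` lie in a neighbourhood -/

/-- **Thin shells lie in neighbourhoods**: if `U` is an open set containing
`{ρ = 0} ∩ B̄(0, 1)` for a continuous `ρ`, then for some `κ > 0` every point of `B̄(0,1)` with
`|ρ| < κ` lies in `U`. [folklore] -/
theorem exists_shell_subset {ρ : E4 → ℝ} (hρ : Continuous ρ) {U : Set E4} (hU : IsOpen U)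
    (hsub : {w | ρ w = 0} ∩ closedBall (0 : E4) 1 ⊆ U) :
    ∃ κ : ℝ, 0 < κ ∧ ∀ w : E4, ‖w‖ ≤ 1 → |ρ w| < κ → w ∈ U := by
  by_contra hcon
  push Not at hcon
  -- a sequence `w n ∈ B̄ ∖ U` with `|ρ (w n)| < 1/(n+1)`
  choose w hw1 hw2 hw3 using fun n : ℕ => hcon (1 / ((n : ℝ) + 1)) (by positivity)
  have hcpt : IsCompact (closedBall (0 : E4) 1) := isCompact_closedBall 0 1
  have hmem : ∀ n, w n ∈ closedBall (0 : E4) 1 := fun n => mem_closedBall_zero_iff.2 (hw1 n)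
  obtain ⟨z, hz, φ, hφ, hlim⟩ := hcpt.tendsto_subseq hmem
  -- `ρ z = 0`
  have hρz : ρ z = 0 := by
    have h1 : Tendsto (fun n => ρ (w (φ n))) atTop (𝓝 (ρ z)) := (hρ.tendsto z).comp hlim
    have h2 : Tendsto (fun n => ρ (w (φ n))) atTop (𝓝 0) := by
      rw [Metric.tendsto_nhds]
      intro ε hε
      obtain ⟨N, hN⟩ := exists_nat_gt (1 / ε)
      filter_upwards [Filter.eventually_ge_atTop N] with n hn
      rw [Real.dist_eq, sub_zero]
      have hφn : (N : ℝ) ≤ (φ n : ℝ) := by exact_mod_cast hn.trans (hφ.id_le n)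
      have h3 := hw2 (φ n)
      have h4 : 1 / ((φ n : ℝ) + 1) < ε := by
        rw [div_lt_iff₀ (by positivity)]
        rw [div_lt_iff₀ hε] at hN
        nlinarith
      linarith
    exact tendsto_nhds_unique h1 h2
  have hzU : z ∈ U := hsub ⟨hρz, hz⟩
  -- but `w (φ n) ∉ U` and `w (φ n) → z ∈ U` open
  have hev : ∀ᶠ n in atTop, w (φ n) ∈ U := hlim (hU.mem_nhds hzU)
  obtain ⟨n, hn⟩ := hev.exists
  exact hw3 (φ n) hn

/-! ### The capped defining function -/

/-- **The capped defining function** `Ψ = m_δ(e^{Cρ} - 1, A(‖w‖² - R²))` of the handlebody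
`K = {ρ ≤ 0}` intersected with the ball `B(0, R)`, corners rounded by the regularised maximum.
[cite: CieliebakEliashberg2012, §3.2] -/
def capPsi (ρ : E4 → ℝ) (C A R δ : ℝ) (w : E4) : ℝ :=
  smoothMax δ (Real.exp (C * ρ w) - 1) (A * (‖w‖ ^ 2 - R ^ 2))

section CapPsi

variable {ρ : E4 → ℝ} {C A R δ : ℝ}

/-- `Ψ` is smooth. [folklore] -/
theorem contDiff_capPsi (hρ : ContDiff ℝ ∞ ρ) : ContDiff ℝ ∞ (capPsi ρ C A R δ) := by
  unfold capPsi
  exact (contDiff_smoothMax (η := δ) (n := ⊤)).comp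
    (((Real.contDiff_exp.comp (contDiff_const.mul hρ)).sub contDiff_const).prodMk
      (contDiff_const.mul ((contDiff_norm_sq ℝ).sub contDiff_const)))

/-- `Ψ ≥ A(‖w‖² - R²)`: the domain `{Ψ ≤ 0}` lies in `B̄(0, R)`. [folklore] -/
theorem norm_le_of_capPsi_nonpos (hδ : 0 < δ) (hA : 0 < A) (hR : 0 < R) {w : E4}
    (hw : capPsi ρ C A R δ w ≤ 0) : ‖w‖ ≤ R := by
  have h1 := max_le_smoothMax hδ (Real.exp (C * ρ w) - 1) (A * (‖w‖ ^ 2 - R ^ 2))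
  have h2 : A * (‖w‖ ^ 2 - R ^ 2) ≤ 0 := (le_max_right _ _).trans (h1.trans hw)
  have h3 : ‖w‖ ^ 2 ≤ R ^ 2 := by nlinarith
  nlinarith [norm_nonneg w]

/-- The first function dominates: `Ψ = e^{Cρ} - 1` near `w` when `e^{Cρ w} - 1 > cap w + δ`.
[folklore] -/
theorem capPsi_eventuallyEq_exp (hρ : Continuous ρ) (hδ : 0 < δ) {w : E4}
    (h : A * (‖w‖ ^ 2 - R ^ 2) + δ < Real.exp (C * ρ w) - 1) :
    capPsi ρ C A R δ =ᶠ[𝓝 w] fun z => Real.exp (C * ρ z) - 1 := by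
  unfold capPsi
  exact smoothMax_comp_eventuallyEq_left hδ
    ((Real.continuous_exp.comp (continuous_const.mul hρ)).sub continuous_const).continuousAt
    (continuous_const.mul ((continuous_norm.pow 2).sub continuous_const)).continuousAt h

/-- The cap dominates: `Ψ = A(‖·‖² - R²)` near `w` when `cap w > e^{Cρ w} - 1 + δ`. [folklore] -/
theorem capPsi_eventuallyEq_cap (hρ : Continuous ρ) (hδ : 0 < δ) {w : E4}
    (h : Real.exp (C * ρ w) - 1 + δ < A * (‖w‖ ^ 2 - R ^ 2)) :
    capPsi ρ C A R δ =ᶠ[𝓝 w] fun z => A * (‖z‖ ^ 2 - R ^ 2) := by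
  unfold capPsi
  exact smoothMax_comp_eventuallyEq_right hδ
    ((Real.continuous_exp.comp (continuous_const.mul hρ)).sub continuous_const).continuousAt
    (continuous_const.mul ((continuous_norm.pow 2).sub continuous_const)).continuousAt h

/-- Transfer of second derivatives along a local equality. [folklore] -/
theorem fderiv_fderiv_congr_of_eventuallyEq {f g : E4 → ℝ} {w : E4} (h : f =ᶠ[𝓝 w] g) :
    fderiv ℝ (fderiv ℝ f) w = fderiv ℝ (fderiv ℝ g) w := by
  have : fderiv ℝ f =ᶠ[𝓝 w] fderiv ℝ g := by
    filter_upwards [h.eventually_nhds] with z hz using (show f =ᶠ[𝓝 z] g from hz).fderiv_eq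
  exact this.fderiv_eq

end CapPsi

/-! ### The capped handlebody has a strongly `J₁`-plurisubharmonic regular defining function -/

namespace HandleProfile

variable {h : ℝ → ℝ} {σ r₀ : ℝ} (H : HandleProfile h σ r₀)
include H

/-- `ρ_K ≤ -σ²` on the plane `x = 0` (the core plane): there `ρ_K = -h(|y|)²`. [folklore] -/
theorem spherical_le_of_x_eq_zero {w : E4} (h0 : w 0 = 0) (h1 : w 1 = 0) :
    spherical (thetaK h) w ≤ -σ ^ 2 := by
  rw [spherical_apply, thetaK_apply, h0, h1]
  have := H.σ_le (Real.sqrt (w 2 ^ 2 + w 3 ^ 2))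
  have := H.σ_pos
  nlinarith

set_option maxHeartbeats 1600000 in
/-- **The capped handlebody `K ∩ B(0,R)` (corners rounded) has a smooth defining function which
is strictly `J₁`-plurisubharmonic on the domain, regular on and outside its boundary (within
the unit ball), vanishes somewhere, confines the domain to `B̄(0,R)`, and agrees with `K` on
`B̄(0, R/2)`.**  (`0 < R < 1`; the function is `Ψ = m_δ(e^{Cρ_K} - 1, A(‖w‖² - R²))` for suitable
`C, A, δ`.) [cite: CieliebakEliashberg2012, §3.2] [cite: ForstnericKozak2003, Cor. 3.2] -/
theorem exists_cap_definingFunction {R : ℝ} (hR0 : 0 < R) (hR1 : R ≤ 1) :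
    ∃ Ψ : E4 → ℝ, ContDiff ℝ ∞ Ψ ∧
      (∀ w, Ψ w ≤ 0 → ‖w‖ ≤ R) ∧
      (∀ w, ‖w‖ ≤ 1 → 0 ≤ Ψ w → fderiv ℝ Ψ w ≠ 0) ∧
      (∀ w, Ψ w ≤ 0 → ∀ u : E4, u ≠ 0 →
        0 < fderiv ℝ (fderiv ℝ Ψ) w u u +
          fderiv ℝ (fderiv ℝ Ψ) w (scaledComplexStructure 1 u) (scaledComplexStructure 1 u)) ∧
      (∃ w, ‖w‖ ≤ 1 ∧ Ψ w = 0) ∧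
      (∀ w, ‖w‖ ≤ R / 2 → (Ψ w ≤ 0 ↔ spherical (thetaK h) w ≤ 0)) := by
  set ρ := spherical (thetaK h) with hρdef
  have hρs : ContDiff ℝ ∞ ρ := contDiff_spherical H.contDiff_thetaK
  have hρc : Continuous ρ := hρs.continuous
  have hθd : Differentiable ℝ (thetaK h) := H.contDiff_thetaK.differentiable (by simp)
  -- the plurisubharmonic collar
  obtain ⟨U, hUo, hKU, C₀, hC₀, hC⟩ := H.exists_psh_definingFunction 1
  set C := C₀ with hCdef
  have hCpos : 0 < C := hC₀
  obtain ⟨κ, hκ, hshell⟩ := exists_shell_subset hρc hUo hKU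
  -- constants
  set κ' := 1 - Real.exp (-(C * κ)) with hκ'
  have hκ'0 : 0 < κ' := by
    rw [hκ']; have := Real.exp_lt_one_iff.2 (by nlinarith [mul_pos hCpos hκ] : -(C * κ) < 0); linarith
  have hκ'1 : κ' < 1 := by rw [hκ']; linarith [Real.exp_pos (-(C * κ))]
  set κ₂ := 1 - Real.exp (-(C * σ ^ 2)) with hκ₂
  have hCσ : 0 < C * σ ^ 2 := mul_pos hCpos (pow_pos H.σ_pos 2)
  have hκ₂0 : 0 < κ₂ := by
    rw [hκ₂]; have := Real.exp_lt_one_iff.2 (by linarith : -(C * σ ^ 2) < 0); linarith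
  set κ₃ := Real.exp (C * κ) - 1 with hκ₃
  have hκ₃0 : 0 < κ₃ := by
    rw [hκ₃]; have := Real.add_one_le_exp (C * κ); nlinarith [mul_pos hCpos hκ]
  set A := κ' / (4 * R ^ 2) with hA
  have hA0 : 0 < A := by rw [hA]; positivity
  have hAR : A * R ^ 2 = κ' / 4 := by rw [hA]; field_simp
  set δ := min (min (κ' / 16) (κ₂ / 4)) κ₃ with hδ
  have hδ0 : 0 < δ := by rw [hδ]; exact lt_min (lt_min (by linarith) (by linarith)) hκ₃0
  have hδ1 : δ ≤ κ' / 16 := (min_le_left _ _).trans (min_le_left _ _)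
  have hδ2 : δ ≤ κ₂ / 4 := (min_le_left _ _).trans (min_le_right _ _)
  have hδ3 : δ ≤ κ₃ := min_le_right _ _
  -- the two functions and `Ψ`
  set Φ : E4 → ℝ := fun w => Real.exp (C * ρ w) - 1 with hΦ
  set cap : E4 → ℝ := fun w => A * (‖w‖ ^ 2 - R ^ 2) with hcap
  have hcapF : cap = capF A R := rfl
  set Ψ := capPsi ρ C A R δ with hΨ
  have hΨeq : Ψ = fun w => smoothMax δ (Φ w) (cap w) := rfl
  have hΦs : ContDiff ℝ ∞ Φ := (Real.contDiff_exp.comp (contDiff_const.mul hρs)).sub contDiff_const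
  have hcaps : ContDiff ℝ ∞ cap := contDiff_const.mul ((contDiff_norm_sq ℝ).sub contDiff_const)
  -- dictionary `Φ > -κ' ↔ ρ > -κ`, and `Φ ≤ 0 ↔ ρ ≤ 0`
  have hΦρ : ∀ w, -κ' < Φ w → -κ < ρ w := by
    intro w hw
    rw [hΦ] at hw; simp only at hw
    have h1 : Real.exp (-(C * κ)) < Real.exp (C * ρ w) := by rw [hκ'] at hw; linarith
    rw [Real.exp_lt_exp] at h1
    nlinarith
  have hΦρ' : ∀ w, Φ w < κ₃ → ρ w < κ := by
    intro w hw
    rw [hΦ] at hw; simp only at hw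
    have h1 : Real.exp (C * ρ w) < Real.exp (C * κ) := by rw [hκ₃] at hw; linarith
    rw [Real.exp_lt_exp] at h1
    nlinarith
  have hΦ_nonpos_iff : ∀ w, Φ w ≤ 0 ↔ ρ w ≤ 0 := by
    intro w
    rw [hΦ]; simp only [sub_nonpos, Real.exp_le_one_iff]
    constructor
    · intro h1; nlinarith
    · intro h1; nlinarith
  -- membership in `U` from the shell
  have hU_of : ∀ w, ‖w‖ ≤ 1 → -κ' < Φ w → Φ w < κ₃ → w ∈ U := fun w hw h1 h2 =>
    hshell w hw (abs_lt.2 ⟨hΦρ w h1, hΦρ' w h2⟩)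
  -- Levi forms of the pieces
  have hLΦ : ∀ w ∈ U, ∀ u : E4, u ≠ 0 → 0 < fderiv ℝ (fderiv ℝ Φ) w u u +
      fderiv ℝ (fderiv ℝ Φ) w (scaledComplexStructure 1 u) (scaledComplexStructure 1 u) := by
    intro w hw u hu
    have h1 := hC C le_rfl w hw u hu
    rw [neg_extDeriv_dComplexFlat_self _ (contDiff_exp_const_mul_comp hρs C)
      (scaledComplexStructure_sq one_ne_zero) w u] at h1
    -- `Φ = e^{Cρ} - 1` has the same second derivative as `e^{Cρ}`
    have h2 : fderiv ℝ (fderiv ℝ Φ) w = fderiv ℝ (fderiv ℝ fun y => Real.exp (C * ρ y)) w := by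
      have : fderiv ℝ Φ = fderiv ℝ fun y => Real.exp (C * ρ y) := by
        rw [hΦ]; funext z; exact fderiv_sub_const _
      rw [this]
    rw [h2]; exact h1
  have hLcap : ∀ w (u : E4), fderiv ℝ (fderiv ℝ cap) w u u +
      fderiv ℝ (fderiv ℝ cap) w (scaledComplexStructure 1 u) (scaledComplexStructure 1 u) = 4 * A * ‖u‖ ^ 2 := by
    intro w u
    rw [hcapF, fderiv_fderiv_capF_apply, fderiv_fderiv_capF_apply, real_inner_self_eq_norm_sq,
      real_inner_self_eq_norm_sq, norm_scaledComplexStructure_one]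
    ring
  refine ⟨Ψ, contDiff_capPsi hρs, fun w hw => norm_le_of_capPsi_nonpos hδ0 hA0 hR0 hw, ?_, ?_, ?_, ?_⟩
  · -- regularity on `{Ψ ≥ 0} ∩ B̄(0,1)`
    intro w hw1 hΨw hd
    have hΦd : DifferentiableAt ℝ Φ w := (hΦs.differentiable (by simp)) w
    have hcapd : DifferentiableAt ℝ cap w := (hcaps.differentiable (by simp)) w
    obtain ⟨hαnn, hβnn, hsum⟩ := smoothMax_weights ((Φ w - cap w) / δ)
    set α := (1 + smoothSign ((Φ w - cap w) / δ)) / 2 with hα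
    set β := (1 - smoothSign ((Φ w - cap w) / δ)) / 2 with hβ
    -- evaluate `dΨ_w` on the `x`-radial vector
    set xv : E4 := WithLp.toLp 2 ![w 0, w 1, 0, 0] with hxv
    have hx0 : xv 0 = w 0 := rfl
    have hx1 : xv 1 = w 1 := rfl
    have hx2 : xv 2 = 0 := rfl
    have hx3 : xv 3 = 0 := rfl
    have hdΨ : fderiv ℝ Ψ w xv = α * fderiv ℝ Φ w xv + β * fderiv ℝ cap w xv := by
      rw [hΨeq, fderiv_smoothMax_comp_apply hδ0.ne' hΦd hcapd]
    have hdΦ : fderiv ℝ Φ w xv = C * Real.exp (C * ρ w) * (2 * (w 0 ^ 2 + w 1 ^ 2)) := by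
      have h1 : fderiv ℝ Φ w = fderiv ℝ (fun y => Real.exp (C * ρ y)) w := by
        rw [hΦ]; exact fderiv_sub_const (1 : ℝ)
      rw [h1, fderiv_exp_const_mul_comp (hρs.differentiable (by simp)) C]
      simp only [FunLike.coe_smul, Pi.smul_apply, smul_eq_mul]
      rw [hρdef, fderiv_spherical_apply hθd, hx0, hx1, hx2, hx3]
      ring
    have hdcap : fderiv ℝ cap w xv = 2 * A * (w 0 ^ 2 + w 1 ^ 2) := by
      rw [hcapF, fderiv_capF_apply, inner_fin_four, hx0, hx1, hx2, hx3]; ring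
    by_cases hx : w 0 ^ 2 + w 1 ^ 2 = 0
    · -- on the core plane `x = 0`: the cap dominates, `dΨ = d cap = 2A⟪w, ·⟫ ≠ 0`
      have hw0 : w 0 = 0 := by nlinarith [sq_nonneg (w 0), sq_nonneg (w 1)]
      have hw1' : w 1 = 0 := by nlinarith [sq_nonneg (w 0), sq_nonneg (w 1)]
      have hρle := H.spherical_le_of_x_eq_zero hw0 hw1'
      have hΦle : Φ w ≤ -κ₂ := by
        rw [hΦ, hκ₂]; simp only
        have : Real.exp (C * ρ w) ≤ Real.exp (-(C * σ ^ 2)) := Real.exp_le_exp.2 (by nlinarith)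
        linarith
      -- `cap w ≥ -δ` since `Ψ w ≥ 0`
      have hcapge : -δ ≤ cap w := by
        have h1 := smoothMax_le_max_add hδ0 (Φ w) (cap w)
        have h2 : 0 ≤ max (Φ w) (cap w) + δ := hΨw.trans h1
        rcases le_total (Φ w) (cap w) with h3 | h3
        · rw [max_eq_right h3] at h2; linarith
        · rw [max_eq_left h3] at h2; linarith
      have hdom : Φ w + δ < cap w := by linarith
      have hev := capPsi_eventuallyEq_cap (C := C) hρc hδ0 hdom
      have hdcap' : fderiv ℝ Ψ w = fderiv ℝ cap w := hev.fderiv_eq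
      -- `w ≠ 0` since `cap w ≥ -δ > -A R²`
      have hw_ne : w ≠ 0 := by
        intro h0
        rw [h0] at hcapge
        simp only [hcap, norm_zero] at hcapge
        nlinarith
      apply hw_ne
      have h3 : fderiv ℝ cap w w = 0 := by rw [← hdcap', hd]; rfl
      rw [hcapF, fderiv_capF_apply, real_inner_self_eq_norm_sq] at h3
      have h4 : ‖w‖ ^ 2 = 0 := by nlinarith
      exact norm_eq_zero.1 (pow_eq_zero_iff two_ne_zero |>.1 h4)
    · -- `x ≠ 0`: `dΨ_w (x, 0) = (αCe^{Cρ} + βA)·2|x|² > 0`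
      have hxpos : 0 < w 0 ^ 2 + w 1 ^ 2 := lt_of_le_of_ne (by positivity) (Ne.symm hx)
      have hcoef : 0 < α * (C * Real.exp (C * ρ w)) + β * A := by
        have h1 : 0 < C * Real.exp (C * ρ w) := mul_pos hCpos (Real.exp_pos _)
        rcases le_or_gt (1 / 2) α with hα' | hα'
        · nlinarith [mul_nonneg hβnn hA0.le]
        · have hβ' : 1 / 2 ≤ β := by linarith
          nlinarith [mul_nonneg hαnn h1.le]
      have h5 : fderiv ℝ Ψ w xv = 0 := by rw [hd]; rfl
      rw [hdΨ, hdΦ, hdcap] at h5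
      nlinarith
  · -- strict plurisubharmonicity on `{Ψ ≤ 0}`
    intro w hΨw u hu
    have hwR : ‖w‖ ≤ R := norm_le_of_capPsi_nonpos hδ0 hA0 hR0 hΨw
    have hw1 : ‖w‖ ≤ 1 := hwR.trans hR1
    have hcap_le : cap w ≤ 0 := by
      have h1 : ‖w‖ ^ 2 ≤ R ^ 2 := pow_le_pow_left₀ (norm_nonneg _) hwR 2
      simp only [hcap]; nlinarith [hA0]
    have hmax : max (Φ w) (cap w) ≤ 0 := (max_le_smoothMax hδ0 _ _).trans hΨw
    have hΦle : Φ w ≤ 0 := (le_max_left _ _).trans hmax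
    have hΦ2 : ContDiffAt ℝ 2 Φ w := (hΦs.of_le (by norm_cast)).contDiffAt
    have hcap2 : ContDiffAt ℝ 2 cap w := (hcaps.of_le (by norm_cast)).contDiffAt
    rcases lt_trichotomy (Φ w) (cap w + δ) with hlt | heq | hgt
    · rcases lt_or_ge (Φ w + δ) (cap w) with hlt2 | hge2
      · -- cap dominates
        rw [fderiv_fderiv_congr_of_eventuallyEq (capPsi_eventuallyEq_cap (C := C) hρc hδ0 hlt2), hLcap]
        positivity
      · -- mixed zone: both within `δ`; `w ∈ U`
        have hwU : w ∈ U := hU_of w hw1 (by nlinarith [hAR, norm_nonneg w, sq_nonneg ‖w‖]) (by linarith)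
        exact levi_flat_smoothMax_pos (scaledComplexStructure 1) hδ0 hΦ2 hcap2 (hLΦ w hwU u hu)
          (by rw [hLcap]; positivity)
    · -- boundary case `Φ = cap + δ`: mixed-zone argument applies verbatim
      have hwU : w ∈ U := hU_of w hw1 (by nlinarith [hAR, norm_nonneg w, sq_nonneg ‖w‖]) (by linarith)
      exact levi_flat_smoothMax_pos (scaledComplexStructure 1) hδ0 hΦ2 hcap2 (hLΦ w hwU u hu)
        (by rw [hLcap]; positivity)
    · -- `Φ` dominates: `Ψ = Φ` near `w`, and `w ∈ U`
      have hwU : w ∈ U := hU_of w hw1 (by nlinarith [hAR, norm_nonneg w, sq_nonneg ‖w‖]) (by linarith)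
      rw [fderiv_fderiv_congr_of_eventuallyEq (capPsi_eventuallyEq_exp (A := A) (R := R) hρc hδ0 hgt)]
      exact hLΦ w hwU u hu
  · -- a zero of `Ψ` on the segment from `0` to `R e₀`
    set e : E4 := WithLp.toLp 2 ![R, 0, 0, 0] with he
    have he_norm : ‖e‖ = R := by
      have := norm_sq_four e
      simp [he] at this
      nlinarith [norm_nonneg e, sq_nonneg (‖e‖ - R), sq_nonneg (‖e‖ + R)]
    set γ : ℝ → ℝ := fun t => Ψ (t • e) with hγ
    have hγc : Continuous γ := (contDiff_capPsi hρs (C := C) (A := A) (R := R) (δ := δ)).continuous.comp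
      (continuous_id.smul continuous_const)
    have hγ0 : γ 0 < 0 := by
      simp only [hγ, zero_smul]
      have h1 := smoothMax_le_max_add hδ0 (Φ 0) (cap 0)
      have hΦ0 : Φ 0 ≤ -κ₂ := by
        have hρ0 := H.spherical_le_of_x_eq_zero (w := 0) rfl rfl
        rw [hΦ, hκ₂]; simp only
        have : Real.exp (C * ρ 0) ≤ Real.exp (-(C * σ ^ 2)) := Real.exp_le_exp.2 (by nlinarith)
        linarith
      have hcap0 : cap 0 = -(A * R ^ 2) := by simp [hcap]
      have h2 : max (Φ 0) (cap 0) + δ < 0 := by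
        rcases le_total (Φ 0) (cap 0) with h3 | h3
        · rw [max_eq_right h3, hcap0]; nlinarith
        · rw [max_eq_left h3]; linarith
      exact lt_of_le_of_lt h1 h2
    have hγ1 : 0 ≤ γ 1 := by
      simp only [hγ, one_smul]
      have hcape : cap e = 0 := by simp [hcap, he_norm]
      rw [hΨeq]
      calc (0 : ℝ) = cap e := hcape.symm
        _ ≤ max (Φ e) (cap e) := le_max_right _ _
        _ ≤ smoothMax δ (Φ e) (cap e) := max_le_smoothMax hδ0 _ _
    obtain ⟨t, ht, hγt⟩ := intermediate_value_Icc zero_le_one hγc.continuousOn ⟨hγ0.le, hγ1⟩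
    refine ⟨t • e, ?_, hγt⟩
    rw [norm_smul, Real.norm_eq_abs, abs_of_nonneg ht.1, he_norm]
    nlinarith [ht.2]
  · -- agreement with `K` on `B̄(0, R/2)`
    intro w hw
    have hcapw : cap w ≤ -(3 * κ' / 16) := by
      simp only [hcap]
      have : ‖w‖ ^ 2 ≤ R ^ 2 / 4 := by nlinarith [norm_nonneg w]
      nlinarith [hAR]
    rcases lt_or_ge (cap w + δ) (Φ w) with h1 | h1
    · -- `Ψ w = Φ w`
      have : Ψ w = Φ w := by rw [hΨeq]; exact smoothMax_eq_left hδ0 h1.le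
      rw [this]; exact hΦ_nonpos_iff w
    · have hΦw : Φ w < 0 := by linarith
      have hρw : ρ w ≤ 0 := (hΦ_nonpos_iff w).1 hΦw.le
      have hΨw : Ψ w ≤ 0 := by
        have h2 := smoothMax_le_max_add hδ0 (Φ w) (cap w)
        rw [hΨeq]
        have h3 : max (Φ w) (cap w) ≤ cap w + δ := max_le h1 (by linarith)
        linarith
      exact ⟨fun _ => hρw, fun _ => hΨw⟩

/-! ### In the standard coordinates of `B⁴`, and the Stein domain -/

/-- **The capped handlebody in the standard coordinates of `B⁴`** (`J₀∂₀ = ∂₁`): transporting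
`exists_cap_definingFunction` by the coordinate swap `σ` (which conjugates `J₁` to `J₀`) gives a
smooth `Ψ` on `ℝ⁴` with `{Ψ ≤ 0} ⊂ B̄(0,R)`, `dΨ ≠ 0` on `{Ψ ≥ 0} ∩ B̄(0,1)`, strictly
`J₀`-plurisubharmonic on `{Ψ ≤ 0}`, vanishing somewhere in `B̄(0,1)`, and
`{Ψ ≤ 0} ∩ B̄(0,R/2) = σ(K) ∩ B̄(0,R/2)`. [cite: CieliebakEliashberg2012, §3.2] -/
theorem exists_cap_definingFunction_std {R : ℝ} (hR0 : 0 < R) (hR1 : R < 1) :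
    ∃ Ψ : E4 → ℝ, ContDiff ℝ ∞ Ψ ∧
      (∀ x : 𝔻⁴, Ψ x ≤ 0 → ‖(x : E4)‖ < 1) ∧
      (∀ x : 𝔻⁴, 0 ≤ Ψ x → fderiv ℝ Ψ (x : E4) ≠ 0) ∧
      (∀ x : 𝔻⁴, Ψ x ≤ 0 → ∀ u : E4, u ≠ 0 →
        0 < fderiv ℝ (fderiv ℝ Ψ) (x : E4) u u +
          fderiv ℝ (fderiv ℝ Ψ) (x : E4) (stdComplexStructure u) (stdComplexStructure u)) ∧
      (∃ x : 𝔻⁴, Ψ x = 0) ∧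
      (∀ w : E4, ‖w‖ ≤ R / 2 → (Ψ w ≤ 0 ↔ spherical (thetaK h) (swap12 w) ≤ 0)) := by
  obtain ⟨Ψ₁, hs, hball, hreg, hlevi, ⟨w₀, hw₀, hΨw₀⟩, hagree⟩ :=
    H.exists_cap_definingFunction hR0 hR1.le
  refine ⟨Ψ₁ ∘ swap12, hs.comp swap12.contDiff, fun x hx => ?_, fun x hx hd => ?_,
    fun x hx u hu => ?_, ?_, fun w hw => ?_⟩
  · have := hball (swap12 x) hx
    rw [norm_swap12] at this
    linarith
  · apply hreg (swap12 x) (by rw [norm_swap12]; exact mem_closedBall_zero_iff.1 x.2) hx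
    have h1 : fderiv ℝ (Ψ₁ ∘ swap12) (x : E4) = (fderiv ℝ Ψ₁ (swap12 x)).comp (swap12 : E4 →L[ℝ] E4) :=
      swap12.comp_right_fderiv
    rw [hd] at h1
    ext v
    have h2 := congrArg (fun L : E4 →L[ℝ] ℝ => L (swap12 v)) h1
    have h3 : ((swap12 : E4 ≃L[ℝ] E4) : E4 →L[ℝ] E4) (swap12 v) = v := swap12_swap12 v
    simp only [ContinuousLinearMap.comp_apply, h3] at h2
    exact h2.symm
  · rw [levi_flat_comp_swap12 hs]
    exact hlevi (swap12 x) hx (swap12 u) fun h0 => hu (by simpa using congrArg swap12 h0)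
  · refine ⟨⟨swap12 w₀, mem_closedBall_zero_iff.2 (by rw [norm_swap12]; exact hw₀)⟩, ?_⟩
    show Ψ₁ (swap12 (swap12 w₀)) = 0
    rw [swap12_swap12]; exact hΨw₀
  · exact hagree (swap12 w) (by rw [norm_swap12]; exact hw)

/-- **The model Stein `2`-handle inside `B⁴` is a Stein domain** (Eliashberg 1990, Lemma
3.4.3 / Forstnerič–Kozak 2003, Cor. 3.2, capped by a ball and rounded; Cieliebak–Eliashberg
2012, Ch. 2–3): for every handle profile `h` (`HandleProfile h σ r₀`, e.g. the rescaled
Forstnerič–Kozak profiles `h_s` of `exists_handleProfile` + `HandleProfile.scale`, whose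
handlebodies `s·K ⊃ D_{λ,s²} ∪ sM` carry the standard `2`-handle at scale `s`) and
`0 < R < 1`, there is a compact regular strongly `J₀`-convex domain `G = {x ∈ B⁴ : Ψ x ≤ 0}`
which **is a Stein domain in the tree's sense** (`isSteinDomain_ballSublevel`) and coincides
on `B̄(0, R/2)` with the handlebody `σ(K)`, `K = {|x| ≤ h(|y|)}` (coordinates swapped so that
the complex structure is the standard `J₀` of `SteinBall.lean`).
[cite: Eliashberg1990Stein, Lemma 3.4.3] [cite: CieliebakEliashberg2012, Def. 1.1 ff.] -/
theorem isSteinDomain_cappedHandle {R : ℝ} (hR0 : 0 < R) (hR1 : R < 1) :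
    ∃ (Ψ : E4 → ℝ) (hΨ : ContDiff ℝ ∞ Ψ) (hin : ∀ x : 𝔻⁴, Ψ x ≤ 0 → ‖(x : E4)‖ < 1)
      (hreg : ∀ x : 𝔻⁴, 0 ≤ Ψ x → fderiv ℝ Ψ (x : E4) ≠ 0),
      (∀ w : E4, ‖w‖ ≤ R / 2 → (Ψ w ≤ 0 ↔ spherical (thetaK h) (swap12 w) ≤ 0)) ∧
      (letI := (SteinStructure.sublevelOfAtlas (contMDiff_comp_coe_ball hΨ) 0 (ball_hint hin)
          (ball_hreg hΨ hreg)).chartedSpace;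
        haveI := (SteinStructure.sublevelOfAtlas (contMDiff_comp_coe_ball hΨ) 0 (ball_hint hin)
          (ball_hreg hΨ hreg)).isManifold;
        haveI := compactSpace_sublevelOf (W := ↥(Metric.closedBall (0 : E4) 1))
          (contMDiff_comp_coe_ball hΨ).continuous 0;
        IsSteinDomain ↥((fun y : 𝔻⁴ => Ψ y) ⁻¹' Iic 0)) := by
  obtain ⟨Ψ, hΨ, hin, hreg, hlevi, hne, hagree⟩ := H.exists_cap_definingFunction_std hR0 hR1
  exact ⟨Ψ, hΨ, hin, hreg, hagree, isSteinDomain_ballSublevel hΨ hin hreg hlevi hne⟩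

end HandleProfile

/-! ### The model of Eliashberg's `2`-handle attachment as a Stein domain -/

/-- **The model Stein `2`-handle is a Stein domain (Eliashberg 1990, Lemma 3.4.3, in the
tree's currency).**  Let `λ > 1`, a scale `s > 0` and `0 < R < 1`.  For every sufficiently
small `ε > 0`, with the Forstnerič–Kozak profile `h` of `exists_handleProfile` (tube radius
`σ < ε`, handle width `τ ∈ (ε, 2ε)`, quadric tail `h(u) = √((u² - 1)/λ)` for
`u ≥ √(λτ² + 1)`), the rescaled handlebody `s·K`, `K = {|x| ≤ h(|y|)} ⊃ D_λ ∪ M` — which for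
`|x| ≥ sτ` is the model domain `D_{λ,s²} = {λ|x|² + s² ≤ |y|²}` and near the core disc
`sM = {x = 0, |y| ≤ s}` is the thin `2`-handle — coincides on `B̄(0, R/2)` (after the coordinate
swap `σ`, `σJ₁σ = J₀`) with a compact regular strongly `J₀`-convex domain
`G = {x ∈ B⁴ : Ψ x ≤ 0}` which **is a Stein domain** (`IsSteinDomain`, with the sublevel
manifold structure and the restriction of the standard Stein structure of `B⁴`).
[cite: Eliashberg1990Stein, Lemma 3.4.3] [cite: ForstnericKozak2003, Cor. 3.2]
[cite: CieliebakEliashberg2012, Def. 1.1 ff.] -/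
theorem exists_isSteinDomain_modelHandle {l s R : ℝ} (hl : 1 < l) (hs : 0 < s) (hR0 : 0 < R) (hR1 : R < 1) :
    ∀ᶠ ε in 𝓝[>] (0 : ℝ), ∃ σ₀ r₀ τ : ℝ, ∃ h : ℝ → ℝ,
      HandleProfile h σ₀ r₀ ∧ σ₀ < ε ∧ ε < τ ∧ τ < 2 * ε ∧
      (∀ u, quadric l τ ≤ u → h u = Real.sqrt ((u ^ 2 - 1) / l)) ∧
      (∀ u, u < quadric l τ → h u < τ) ∧
      ∃ (Ψ : E4 → ℝ) (hΨ : ContDiff ℝ ∞ Ψ) (hin : ∀ x : 𝔻⁴, Ψ x ≤ 0 → ‖(x : E4)‖ < 1)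
        (hreg : ∀ x : 𝔻⁴, 0 ≤ Ψ x → fderiv ℝ Ψ (x : E4) ≠ 0),
        (∀ w : E4, ‖w‖ ≤ R / 2 →
          (Ψ w ≤ 0 ↔ spherical (thetaK fun u => s * h (u / s)) (swap12 w) ≤ 0)) ∧
        (letI := (SteinStructure.sublevelOfAtlas (contMDiff_comp_coe_ball hΨ) 0 (ball_hint hin)
            (ball_hreg hΨ hreg)).chartedSpace;
          haveI := (SteinStructure.sublevelOfAtlas (contMDiff_comp_coe_ball hΨ) 0 (ball_hint hin)
            (ball_hreg hΨ hreg)).isManifold;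
          haveI := compactSpace_sublevelOf (W := ↥(Metric.closedBall (0 : E4) 1))
            (contMDiff_comp_coe_ball hΨ).continuous 0;
          IsSteinDomain ↥((fun y : 𝔻⁴ => Ψ y) ⁻¹' Iic 0)) := by
  filter_upwards [exists_handleProfile hl] with ε hε
  obtain ⟨σ₀, r₀, τ, h, H, hσε, -, hετ, hτ, -, htail, hlt⟩ := hε
  exact ⟨σ₀, r₀, τ, h, H, hσε, hετ, hτ, htail, hlt, (H.scale hs).isSteinDomain_cappedHandle hR0 hR1⟩

end Literature.Geometry.Symplectic

end
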